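import Summits.ResolutionOfSingularities.KangarooAtlas.MizutaniRootTowerBridge
import HarnessLib

/-!
# Mizutani's conjecture `m(e) = 2p^e − 1` — THEOREM F for towers `K = L(x^{1/q})`

Cell topic `Summits/ResolutionOfSingularities/KangarooAtlas` (pub-rosobs); namespace
`Summit.ResolutionOfSingularities.KangarooAtlas.Mizutani`.  Part of the Lean transcription of the
in-house note MIZUTANI-PROOF-g59 (AI-written, AI-audited; *AI review is weaker than expert review*; not a
resolution theorem).  This file closes the tower envelope:

* `IsRootTower.prod_pow_mem_span` / `finiteDimensional` — `K` is spanned over `L` by the box monomials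
  `a^W` (§1.1);
* `IsRootTower.Omega_map` — the intertwining `Ω ∘ (sigD_T ⊗ 1) = E_T ∘ Ω` for `|T| + 1 ≤ q`, from the core
  identity on `y ⊗ a^W` (`opE_C_mul_pPlus`) by linearity and spanning;
* `IsRootTower.boxBridge` — the `BoxTowerBridge` of a tower, and
* **THEOREM F** (`theoremF_rootTower`; MIZUTANI-PROOF-g59 §2/§9): for every tower `K = L(x^{1/q})` with
  `s ≥ 2` directions over an infinite field `L` of characteristic `p` (`q = p^e`, `e ≥ 1`) and every
  `ω ∈ K ⊗_L K` whose coordinates `Ω ω` involve only monomials of degree `≥ q` and some GENUINE monomial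
  (`ω ∈ J^q ∖ I_S`, §1.2), the tensor rank of `ω` over `L` is at least `2q`.  By the note's §3 (Oda 1983-II
  Cor. 2.3 / Thm. 3.1, cited there) this is the statement that every Hironaka additive group scheme of exponent
  `≥ e` has dimension `≥ 2p^e − 1`; that dictionary is NOT formalised here.

References: [Mizutani1973HironakaGroupSchemes] (Remark 2.10; in-house proof §1–§2, §9);
[Oda1983HironakaGroupSchemeII] (§1 p. 1166; Cor. 2.3, Thm. 3.1 for the dictionary); [EGAIV4] Thm. 16.11.2.
-/

open MvPolynomial TensorProduct Literature.AlgebraicGeometry.Resolution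

namespace Summit.ResolutionOfSingularities.KangarooAtlas.Mizutani

section TheoremF

variable {L K : Type*} [Field L] [Field K] [Algebra L K] {s p e : ℕ} [hp : Fact p.Prime] [CharP K p]
  {x : Fin s → L} {a : Fin s → K}

/-- The canonical map of the presentation on a polynomial is evaluation at `a`. [folklore] -/
theorem liftHom_mk {q : ℕ} (hz : ∀ i, a i ^ q = algebraMap L K (x i)) (F : MvPolynomial (Fin s) L) :
    liftHom a hz (Ideal.Quotient.mk _ F) = aeval a F := by
  unfold liftHom
  rw [Ideal.Quotient.liftₐ_apply, Ideal.Quotient.lift_mk]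
  rfl

/-- The box monomials in the `p`-basis. [cite: Mizutani1973HironakaGroupSchemes, Remark 2.10 (in-house proof §1.1, the basis a^W)] -/
def boxMonomials (a : Fin s → K) (q : ℕ) : Set K :=
  {m | ∃ W : Fin s →₀ ℕ, InBox q W ∧ m = ∏ i, a i ^ W i}

omit [CharP K p] in
/-- **Every monomial `a^N` lies in the `L`-span of the box monomials** (reduce exponents with `a_i^q = x_i`).
[cite: Mizutani1973HironakaGroupSchemes, Remark 2.10 (in-house proof §1.1)] -/
theorem IsRootTower.prod_pow_mem_span (h : IsRootTower L K (p ^ e) x a) (N : Fin s →₀ ℕ) :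
    (∏ i, a i ^ N i) ∈ Submodule.span L (boxMonomials a (p ^ e)) := by
  have hq : 0 < p ^ e := pow_pos hp.out.pos e
  set W : Fin s →₀ ℕ := Finsupp.equivFunOnFinite.symm fun i => N i % p ^ e with hW
  have hWi : ∀ i, W i = N i % p ^ e := fun i => by rw [hW, Finsupp.coe_equivFunOnFinite_symm]
  have hsplit : (∏ i, a i ^ N i) = algebraMap L K (∏ i, x i ^ (N i / p ^ e)) * ∏ i, a i ^ W i := by
    rw [map_prod, ← Finset.prod_mul_distrib]
    refine Finset.prod_congr rfl fun i _ => ?_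
    rw [map_pow, ← h.pow_eq i, ← pow_mul, ← pow_add, hWi, Nat.div_add_mod]
  rw [hsplit, ← Algebra.smul_def]
  refine Submodule.smul_mem _ _ (Submodule.subset_span ⟨W, fun i => ?_, rfl⟩)
  rw [hWi]; exact Nat.mod_lt _ hq

omit [CharP K p] in
/-- **`K` is spanned over `L` by the box monomials.** [cite: Mizutani1973HironakaGroupSchemes, Remark 2.10 (in-house proof §1.1)] -/
theorem IsRootTower.mem_span (h : IsRootTower L K (p ^ e) x a) (z : K) :
    z ∈ Submodule.span L (boxMonomials a (p ^ e)) := by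
  obtain ⟨ξ, rfl⟩ := h.bijective.2 z
  obtain ⟨F, rfl⟩ := Ideal.Quotient.mk_surjective ξ
  rw [liftHom_mk, aeval_def, eval₂_eq']
  refine Submodule.sum_mem _ fun d _ => ?_
  rw [← Algebra.smul_def]
  exact Submodule.smul_mem _ _ (h.prod_pow_mem_span d)

omit [CharP K p] in
/-- A tower is finite-dimensional over its ground field. [cite: Mizutani1973HironakaGroupSchemes, Remark 2.10 (in-house proof §1.1: [k : L] = q^s)] -/
theorem IsRootTower.finiteDimensional (h : IsRootTower L K (p ^ e) x a) :
    FiniteDimensional L K := by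
  classical
  have hfin : (boxMonomials a (p ^ e)).Finite := by
    have : boxMonomials a (p ^ e) ⊆ (fun W : Fin s →₀ ℕ => ∏ i, a i ^ W i) '' (boxFinset (Fin s) (p ^ e) : Set _) := by
      rintro _ ⟨W, hW, rfl⟩
      exact ⟨W, Finset.mem_coe.mpr (mem_boxFinset.mpr hW), rfl⟩
    exact Set.Finite.subset ((boxFinset (Fin s) (p ^ e)).finite_toSet.image _) this
  refine ⟨⟨hfin.toFinset, ?_⟩⟩
  rw [Set.Finite.coe_toFinset]
  exact eq_top_iff.mpr fun z _ => h.mem_span z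

/-- **The intertwining** `Ω ∘ (sigD_T ⊗ 1) = E_T ∘ Ω` for `|T| + 1 ≤ q` (MIZUTANI-PROOF-g59 §1.4: the operators
`(D ⊗ 1)` read in left `t`-coordinates). [cite: Mizutani1973HironakaGroupSchemes, Remark 2.10 (in-house proof §1.4 MONOMIALS and Leibniz)] -/
theorem IsRootTower.Omega_map (h : IsRootTower L K (p ^ e) x a) (T : Fin s →₀ ℕ) (ω : K ⊗[L] K)
    (hT : T.degree + 1 ≤ p ^ e) :
    h.Omega (TensorProduct.map (h.sigD T) LinearMap.id ω) =
      opE (fun T => (h.sigD T).toAddMonoidHom) T (h.Omega ω) := by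
  classical
  have hTbox : InBox (p ^ e) T := fun i => by
    have := Finsupp.le_degree i T
    omega
  induction ω using TensorProduct.induction_on with
  | zero => rw [map_zero, map_zero, opE_zero_right]
  | tmul y z =>
    -- reduce to `z` a box monomial, for all `y`
    revert y
    refine Submodule.span_induction (p := fun z _ => ∀ y : K,
        h.Omega (TensorProduct.map (h.sigD T) LinearMap.id (y ⊗ₜ[L] z)) =
          opE (fun T => (h.sigD T).toAddMonoidHom) T (h.Omega (y ⊗ₜ[L] z))) ?_ ?_ ?_ ?_ (h.mem_span z)
    · rintro _ ⟨W, hW, rfl⟩ y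
      have htau : truncQ (Fin s) K (p ^ e) (h.tau (∏ i, a i ^ W i)) = pPlus a W := by
        rw [h.tau_prod_pow, truncQ_mk]
        exact trunc_eq_self fun V hV => inBox_of_mem_support_pPlus hW hV
      rw [TensorProduct.map_tmul, LinearMap.id_apply, h.Omega_tmul, h.Omega_tmul, htau,
        h.opE_C_mul_pPlus W hTbox]
    · intro y
      rw [TensorProduct.tmul_zero, map_zero, map_zero, opE_zero_right]
    · intro z₁ z₂ _ _ h₁ h₂ y
      rw [TensorProduct.tmul_add, map_add, map_add, map_add, opE_add, h₁, h₂]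
    · intro c z _ hz y
      have : y ⊗ₜ[L] (c • z) = (c • y) ⊗ₜ[L] z := by
        rw [TensorProduct.tmul_smul, TensorProduct.smul_tmul']
      simp only [this]
      exact hz (c • y)
  | add ω₁ ω₂ h₁ h₂ => rw [map_add, map_add, map_add, opE_add, h₁, h₂]

/-- **The bridge of a tower**: its (anti-)Hasse–Schmidt operators and its coordinate map satisfy the axioms of
`BoxTowerBridge`. [cite: Oda1983HironakaGroupSchemeII, §1 (p. 1166)] -/
noncomputable def IsRootTower.boxBridge (h : IsRootTower L K (p ^ e) x a) : BoxTowerBridge L K p e s where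
  D := h.sigD
  Ω := h.Omega
  D_zero := h.sigD_zero
  Ω_map T ω hT := h.Omega_map T ω hT
  Ω_coeff_zero := h.Omega_coeff_zero
  Ω_box := h.Omega_box

/-- **THEOREM F** (MIZUTANI-PROOF-g59 §2 / §9, rank form, for every tower `K = L(x^{1/q}) ⊃ L`): let `L` be an
infinite field of characteristic `p`, `q = p^e` with `e ≥ 1`, `x_1, …, x_s ∈ L` (`s ≥ 2`) with
`K = L(x^{1/q})` of degree `q^s` (`IsRootTower`).  Every `ω ∈ K ⊗_L K` whose left coordinates `Ω ω` in
`t = 1 ⊗ a − a ⊗ 1` involve only monomials of degree `≥ q` and at least one GENUINE monomial (`ω ∈ J^q ∖ I_S`)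
has tensor rank `≥ 2q` over `L`.  With Lemma 1.5 and the profile theorem this is the whole chain §§4–9 of the
note, with §5/§8/§9 replaced by the presentation-level argument (vertex bound, clean layers, spreading); the
translation to Hironaka group schemes (§3, Oda 1983-II) is not formalised.
[cite: Mizutani1973HironakaGroupSchemes, Remark 2.10 (in-house proof §2 / §9, THEOREM F)] -/
theorem theoremF_rootTower [Infinite L] (h : IsRootTower L K (p ^ e) x a) (hs : 2 ≤ s) (he : 1 ≤ e)
    (ω : K ⊗[L] K) (hdeg : ∀ M ∈ (h.Omega ω).support, p ^ e ≤ M.degree)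
    (hgen : ∃ M ∈ (h.Omega ω).support, IsGenuine p e M) : 2 * p ^ e ≤ tensorRank L ω := by
  haveI := h.finiteDimensional
  exact theoremF_rank_of_boxBridge h.boxBridge hs he ω hdeg hgen

end TheoremF

end Summit.ResolutionOfSingularities.KangarooAtlas.Mizutani
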